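import Summits.AtomisticToContinuum.HydrodynamicLimit.Theorems.RelayRaceLocalityRestartPrincipleStubMeanClosure
import Summits.AtomisticToContinuum.HydrodynamicLimit.Theorems.RelayRaceLocalityRestartPrincipleStubEulerProfileFamily
import Summits.AtomisticToContinuum.HydrodynamicLimit.Theorems.RelayRaceLocalityRestartPrincipleStubMeansByCharacteristics
import Summits.AtomisticToContinuum.HydrodynamicLimit.Theorems.RelayRaceLocalityRestartPrincipleMeanMapRegularityDensity
import Summits.AtomisticToContinuum.HydrodynamicLimit.Theorems.RelayRaceLocalityRestartPrincipleMmrMomentum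
import Summits.AtomisticToContinuum.HydrodynamicLimit.Theorems.RelayRaceLocalityRestartPrincipleMmrEnergy
import Summits.AtomisticToContinuum.HydrodynamicLimit.Theorems.RelayRaceLocalityRestartPrincipleOfConjunct
import HarnessLib

/-!
# Crux `RestartPrinciple` (stmt-AtomisticToContinuum-12503) — line `IdeatorFourSketch` (card `age-duhamel-forgetting`), skeleton v4 (lead c10)

Route `RelayRaceLocality`; crux decl
`Summit.AtomisticToContinuum.HydrodynamicLimit.Theses.RelayRaceLocality.RestartPrinciple` `= (S → G)`, `G` VERBATIM the body of the
re-typed sub-problem decl `_root_.HydrodynamicLimit` (p126922); `G → S` landed (p101123), `S` not consumable (p99454): the line proves `G`.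

THE LINE: dock the crux onto the MEAN-MAP PROGRAMME of route `ResponseRigidity` —
`RestartPrinciple ⟸ HydrodynamicLimit ⟸ MeanHydroLimitInBand (11927) ∧ MeanClosure (11929)`,
`MeanHydroLimitInBand ⟸ MeansByCharacteristics (15334)(FlowBoxDecoupling 15329, MeanMapRegularity 15330, EulerProfileFamily 15331)`
(composition LANDED: `Theorems.RestartPrinciple.restartPrinciple_of_meansByCharacteristics`, p132793).

v4 = IMPORT FORM + RESHAPE OF THE MEAN-MAP REGULARITY STUB (this seat, after wave 2):
* `MeanClosure` (stmt-11929) — PROVED, imported (`Theorems.RestartPrinciple.AgeDuhamelForgetting.meanClosure_holds`, p128739, lead a2; item closed);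
* `EulerProfileFamily` (stmt-15331) — PROVED, imported (`….stub_eulerProfileFamily`, p127927; item closed);
* `MeansByCharacteristics` (stmt-15334) — PROVED, imported (`….meansByCharacteristics_holds`, p128457; item closed);
* `MeanMapRegularity` (stmt-15330) — DERIVED here (`stub_meanMapRegularity`, sorry-free) from the landed density clause
  (`meanMapRegularity_density`, p129093), the landed reductions of the momentum clause to the MEAN COLLISION-FLUX BOUND along the
  family (`mmr_momentum_of_collisionFlux`, p134109) and of the energy clause to the energy-weighted flux bound plus CUBIC VELOCITY
  MOMENTS along the flow (`mmr_energy_of_collisionFlux_of_cubicMoment`, p134768), and TWO NEW REGISTERED STUBS carrying exactly those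
  inputs in the item's own quantifier frame:
  - `stub_collisionFluxAlongFamily` — `(ε/(N+1))·E_{LG_τ}[Σ_{collisions in [0,s]} ‖vᵢ−v_k‖ (·(‖vᵢ‖+‖v_k‖))] ≤ C s + e_N` under the
    flow-evolved NON-invariant local Gibbs laws of the activity family (proved at constant profiles: `mmr_collisionFlux_const` p134422,
    `mmr_energyCollisionFlux_const` p134646; open otherwise — the one-window flux of Cercignani–Illner–Pulvirenti for `(Φ_r)_* LG_τ`,
    content of `OneFlightGossipEngine.CollisionActivityTails`, stmt-13734);
  - `stub_cubicMomentAlongFamily` — `E_{LG_τ}[(N+1)⁻¹ Σ ‖vᵢ(r)‖³] ≤ C₃` along the flow (constant profiles: `mmr_cubicMoment_const`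
    p134646; open otherwise: entropy `H(LG_τ | Gibbs) = O(N)` bounds second velocity moments along the flow, not third);
* `FlowBoxDecoupling` (stmt-15329) — `stub_flowBoxDecoupling`, THE RESIDUE (open-problem: birth-covariance decay at positive lag).
Sorries: `stub_collisionFluxAlongFamily`, `stub_cubicMomentAlongFamily`, `stub_flowBoxDecoupling`; everything else imported or proved.
-/

noncomputable section

open scoped ENNReal
open Literature.MathematicalPhysics.KineticTheory Literature.Analysis.FluidPDE
open Literature.Analysis.FunctionSpaces MeasureTheory Filter Set Topology
open Summit.AtomisticToContinuum.HydrodynamicLimit.Theses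
open Summit.AtomisticToContinuum.HydrodynamicLimit.Theses.RelayRaceLocality
open Summit.AtomisticToContinuum.HydrodynamicLimit.Theorems.RestartPrinciple
open Summit.AtomisticToContinuum.HydrodynamicLimit.Theorems.RestartPrinciple.AgeDuhamelForgetting
  (meanClosure_holds meansByCharacteristics_holds meanMapRegularity_density mmr_momentum_of_collisionFlux
    mmr_energy_of_collisionFlux_of_cubicMoment)

namespace Summit.AtomisticToContinuum.HydrodynamicLimit.Cruxes.RestartPrinciple.AgeDuhamelForgetting

/-! ## The stubs (open) -/

/-- STUB CF (open dynamical content of the momentum/energy clauses of stmt-15330): the MEAN COLLISION-FLUX BOUNDS along an Euler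
activity family — for `s, τ ∈ [0,t]`, `s + τ ≤ t`, the `ε/(N+1)`-scaled expected collision sums over `[0,s]` of the marks
`‖vᵢ − v_k‖` and `‖vᵢ − v_k‖(‖vᵢ‖ + ‖v_k‖)` under `LG_τ = localGibbsLaw σ (a τ) (u τ) (θ τ) N (Φ N)` are `≤ C s + e_N`, `e_N → 0`
(Boltzmann–Enskog flux scale `σ³·s`; proved at constant profiles by stationarity, p134422/p134646; for non-constant profiles it is
the one-window contact flux of the flow-evolved, non-invariant law). -/
theorem stub_collisionFluxAlongFamily :
    ∃ η : ℝ, 0 < η ∧ ∀ (a₀ θ₀ : T3 → ℝ) (u₀ : T3 → V3), Continuous a₀ → Continuous θ₀ → Continuous u₀ → (∀ x, 0 < a₀ x) → (∀ x, 0 < θ₀ x) → ∃ σ₀ : ℝ, 0 < σ₀ ∧ ∀ σ : ℝ, 0 < σ → σ < σ₀ → ∀ (T : ℝ) (ρ θ : ℝ → T3 → ℝ) (u : ℝ → T3 → V3), IsHardSphereEulerSolution σ T ρ u θ → (∀ t ∈ Set.Ico 0 T, ∀ x, ρ t x * σ ^ 3 < η) → ∀ Φ : (N : ℕ) → HardSphereFlow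 (Torus.geometry (Fin 3)) (hsDiameter σ N) (N + 1), TendstoHydroFieldsAt (fun N => localGibbsLaw σ a₀ u₀ θ₀ N (Φ N)) Φ ρ u θ 0 → ∀ a : ℝ → T3 → ℝ, a 0 = a₀ → (∀ τ ∈ Set.Ico 0 T, Continuous (a τ) ∧ ∀ x, 0 < a τ x) → (∀ τ ∈ Set.Ico 0 T, ∀ χ : T3 → ℝ, Literature.Analysis.FunctionSpaces.Torus.IsSmooth χ → Tendsto (fun N : ℕ => ∫ z, empiricalDensityField z χ ∂(localGibbsLaw σ (a τ) (u τ) (θ τ) N (Φ N))) atTop (𝓝 (∫ x, χ x * ρ τ x)) ∧ (∀ j : Fin 3, Tendsto (fun N : ℕ => ∫ z, empiricalMomentumField z χ j ∂(localGibbsLaw σ (a τ) (u τ) (θ τ) N (Φ N))) atTop (𝓝 (∫ x, χ x * ρ τ x * u τ x j))) ∧ Tendsto (fun N : ℕ => ∫ z, empiricalEnergyField z χ ∂(localGibbsLaw σ (a τ) (u τ) (θ τ) N (Φ N))) atTop (𝓝 (∫ x, χ x * totalEnergyDensity (ρ τ x) (u τ x) (θ τ x)))) → ∀ t ∈ Set.Ico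 0 T, (∃ CK : ℝ, ∃ eK : ℕ → ℝ, Tendsto eK atTop (𝓝 0) ∧ ∀ N : ℕ, ∀ s ∈ Set.Icc 0 t, ∀ τ ∈ Set.Icc 0 t, s + τ ≤ t → ENNReal.ofReal (hsDiameter σ N / ((N + 1 : ℕ) : ℝ)) * ∫⁻ z, (∑ᶠ r ∈ collisionTimes (Torus.geometry (Fin 3)) (hsDiameter σ N) (fun t => (Φ N).flow t z) ∩ Set.Icc 0 s, ∑ i, ∑ k, (if i ≠ k ∧ ‖(Torus.geometry (Fin 3)).sepVec ((Φ N).flow r z i).1 ((Φ N).flow r z k).1‖ = hsDiameter σ N then ENNReal.ofReal ‖((Φ N).flow r z i).2 - ((Φ N).flow r z k).2‖ else 0)) ∂(localGibbsLaw σ (a τ) (u τ) (θ τ) N (Φ N)) ≤ ENNReal.ofReal (CK * s + eK N)) ∧ (∃ CE : ℝ, ∃ eE : ℕ → ℝ, Tendsto eE atTop (𝓝 0) ∧ ∀ N : ℕ, ∀ s ∈ Set.Icc 0 t, ∀ τ ∈ Set.Icc 0 t, s + τ ≤ t → ENNReal.ofReal (hsDiameter σ N / ((N + 1 : ℕ)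 : ℝ)) * ∫⁻ z, (∑ᶠ r ∈ collisionTimes (Torus.geometry (Fin 3)) (hsDiameter σ N) (fun t => (Φ N).flow t z) ∩ Set.Icc 0 s, ∑ i, ∑ k, (if i ≠ k ∧ ‖(Torus.geometry (Fin 3)).sepVec ((Φ N).flow r z i).1 ((Φ N).flow r z k).1‖ = hsDiameter σ N then ENNReal.ofReal (‖((Φ N).flow r z i).2 - ((Φ N).flow r z k).2‖ * (‖((Φ N).flow r z i).2‖ + ‖((Φ N).flow r z k).2‖)) else 0)) ∂(localGibbsLaw σ (a τ) (u τ) (θ τ) N (Φ N)) ≤ ENNReal.ofReal (CE * s + eE N)) := by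
  sorry

/-- STUB C3 (open; input of the energy clause of stmt-15330): CUBIC VELOCITY MOMENTS ALONG THE FLOW — `E_{LG_τ}[(N+1)⁻¹ Σᵢ ‖vᵢ(r)‖³] ≤ C₃`
for `r, τ ∈ [0,t]`, `r + τ ≤ t`, uniformly in `N` (constant profiles: invariant law, Gaussian moments, p134646; in general it says no
fat velocity tails develop dynamically — relative entropy per particle controls second moments only). -/
theorem stub_cubicMomentAlongFamily :
    ∃ η : ℝ, 0 < η ∧ ∀ (a₀ θ₀ : T3 → ℝ) (u₀ : T3 → V3), Continuous a₀ → Continuous θ₀ → Continuous u₀ → (∀ x, 0 < a₀ x) → (∀ x, 0 < θ₀ x) → ∃ σ₀ : ℝ, 0 < σ₀ ∧ ∀ σ : ℝ, 0 < σ → σ < σ₀ → ∀ (T : ℝ) (ρ θ : ℝ → T3 → ℝ) (u : ℝ → T3 → V3), IsHardSphereEulerSolution σ T ρ u θ → (∀ t ∈ Set.Ico 0 T, ∀ x, ρ t x * σ ^ 3 < η) → ∀ Φ : (N : ℕ) → HardSphereFlow (Torus.geometry (Fin 3)) (hsDiameter σ N) (N + 1), TendstoHydroFieldsAt (fun N =>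 localGibbsLaw σ a₀ u₀ θ₀ N (Φ N)) Φ ρ u θ 0 → ∀ a : ℝ → T3 → ℝ, a 0 = a₀ → (∀ τ ∈ Set.Ico 0 T, Continuous (a τ) ∧ ∀ x, 0 < a τ x) → (∀ τ ∈ Set.Ico 0 T, ∀ χ : T3 → ℝ, Literature.Analysis.FunctionSpaces.Torus.IsSmooth χ → Tendsto (fun N : ℕ => ∫ z, empiricalDensityField z χ ∂(localGibbsLaw σ (a τ) (u τ) (θ τ) N (Φ N))) atTop (𝓝 (∫ x, χ x * ρ τ x)) ∧ (∀ j : Fin 3, Tendsto (fun N : ℕ => ∫ z, empiricalMomentumField z χ j ∂(localGibbsLaw σ (a τ) (u τ) (θ τ) N (Φ N))) atTop (𝓝 (∫ x, χ x * ρ τ x * u τ x j))) ∧ Tendsto (fun N : ℕ => ∫ z, empiricalEnergyField z χ ∂(localGibbsLaw σ (a τ) (u τ) (θ τ) N (Φ N))) atTop (𝓝 (∫ x, χ x * totalEnergyDensity (ρ τ x) (u τ x) (θ τ x)))) → ∀ t ∈ Set.Ico 0 T, (∃ C3 : ℝ, ∀ N : ℕ, ∀ r ∈ Set.Icc 0 t,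 ∀ τ ∈ Set.Icc 0 t, r + τ ≤ t → ∫⁻ z, ENNReal.ofReal ((((N + 1 : ℕ) : ℝ))⁻¹ * ∑ i, ‖((Φ N).flow r z i).2‖ ^ 3) ∂(localGibbsLaw σ (a τ) (u τ) (θ τ) N (Φ N)) ≤ ENNReal.ofReal C3) := by
  sorry

/-- STUB FBD (open-problem; THE RESIDUE; = shared support item stmt-AtomisticToContinuum-15329 `ResponseRigidity.FlowBoxDecoupling`
verbatim): FLOW-BOX DECOUPLING of the two-parameter mean map, `|M^N(s+h,τ) − M^N(s,τ+h)| ≤ κh` for `s ≥ δ`, small `h`, large `N` — the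
card's birth-covariance decay `⟨⟨W_τ ; Y_s⟩⟩ → 0` (McLennan–Zubarev / TTCF) in derivative-free form. -/
theorem stub_flowBoxDecoupling : ResponseRigidity.FlowBoxDecoupling := by
  sorry

/-! ## Derived: the mean-map regularity (stmt-15330) from CF + C3 over the landed density clause and reductions -/

/-- DERIVED STUB MMR (= shared support item stmt-AtomisticToContinuum-15330 `ResponseRigidity.MeanMapRegularity` verbatim), sorry-free
modulo `stub_collisionFluxAlongFamily` and `stub_cubicMomentAlongFamily`: `η := min η_ρ (min η_CF η_C3)`, `σ₀ := min (min σ_ρ (min σ_CF σ_C3)) (1/2)`;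
density clause from `meanMapRegularity_density` (p129093, `e ≡ 0`), momentum clause from `mmr_momentum_of_collisionFlux` (p134109) fed
with CF's first conjunct, energy clause from `mmr_energy_of_collisionFlux_of_cubicMoment` (p134768) fed with CF's second conjunct and C3;
the three `(C, e)` pairs are merged as `C := C_ρ + C_m + C_E`, `e := |e_m| + |e_E|`. -/
theorem stub_meanMapRegularity : ResponseRigidity.MeanMapRegularity := by
  obtain ⟨η₁, hη₁, H₁⟩ := meanMapRegularity_density
  obtain ⟨η₂, hη₂, H₂⟩ := stub_collisionFluxAlongFamily
  obtain ⟨η₃, hη₃, H₃⟩ := stub_cubicMomentAlongFamily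
  refine ⟨min η₁ (min η₂ η₃), lt_min hη₁ (lt_min hη₂ hη₃), ?_⟩
  intro a₀ θ₀ u₀ ha hθ hu ha0 hθ0
  obtain ⟨σ₁, hσ₁, G₁⟩ := H₁ a₀ θ₀ u₀ ha hθ hu ha0 hθ0
  obtain ⟨σ₂, hσ₂, G₂⟩ := H₂ a₀ θ₀ u₀ ha hθ hu ha0 hθ0
  obtain ⟨σ₃, hσ₃, G₃⟩ := H₃ a₀ θ₀ u₀ ha hθ hu ha0 hθ0
  refine ⟨min (min σ₁ (min σ₂ σ₃)) (1 / 2), lt_min (lt_min hσ₁ (lt_min hσ₂ hσ₃)) one_half_pos, ?_⟩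
  intro σ hσ hσ' T ρ θ u hE hpack Φ h0 a ha0' hapos hmeans t ht χ hχ
  have hσ1 : σ < σ₁ := hσ'.trans_le ((min_le_left _ _).trans (min_le_left _ _))
  have hσ2 : σ < σ₂ := hσ'.trans_le ((min_le_left _ _).trans ((min_le_right _ _).trans (min_le_left _ _)))
  have hσ3 : σ < σ₃ := hσ'.trans_le ((min_le_left _ _).trans ((min_le_right _ _).trans (min_le_right _ _)))
  have hσh : σ ≤ 1 / 2 := (hσ'.trans_le (min_le_right _ _)).le
  have hp1 : ∀ s ∈ Set.Ico 0 T, ∀ x, ρ s x * σ ^ 3 < η₁ :=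
    fun s hs x => (hpack s hs x).trans_le (min_le_left _ _)
  have hp2 : ∀ s ∈ Set.Ico 0 T, ∀ x, ρ s x * σ ^ 3 < η₂ :=
    fun s hs x => (hpack s hs x).trans_le ((min_le_right _ _).trans (min_le_left _ _))
  have hp3 : ∀ s ∈ Set.Ico 0 T, ∀ x, ρ s x * σ ^ 3 < η₃ :=
    fun s hs x => (hpack s hs x).trans_le ((min_le_right _ _).trans (min_le_right _ _))
  -- density clause (e ≡ 0)
  obtain ⟨Cρ, hCρ⟩ := G₁ σ hσ hσ1 T ρ θ u hE hp1 Φ h0 a ha0' hapos hmeans t ht χ hχ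
  -- collision-flux inputs and cubic moments at this t
  obtain ⟨hK, hEfl⟩ := G₂ σ hσ hσ2 T ρ θ u hE hp2 Φ h0 a ha0' hapos hmeans t ht
  have h3 := G₃ σ hσ hσ3 T ρ θ u hE hp3 Φ h0 a ha0' hapos hmeans t ht
  -- momentum and energy clauses by the landed reductions
  obtain ⟨Cm, em, hem, hCm⟩ := mmr_momentum_of_collisionFlux σ hσ hσh T ρ θ u hE Φ a hapos t ht hK χ hχ
  obtain ⟨CE, eE, heE, hCE⟩ := mmr_energy_of_collisionFlux_of_cubicMoment σ hσ hσh T ρ θ u hE Φ a hapos t ht hEfl h3 χ hχ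
  refine ⟨Cρ + Cm + CE, fun N => |em N| + |eE N|, ?_, ?_⟩
  · have := (hem.abs.add heE.abs)
    simpa using this
  intro N s hs τ hτ hst
  have hs0 : 0 ≤ s := hs.1
  have hρ := hCρ N s hs τ hτ hst
  have hm := hCm N s hs τ hτ hst
  have hen := hCE N s hs τ hτ hst
  -- nonnegativity of the three constants' contributions: from the bounds at hand
  have hCρs : 0 ≤ Cρ * s := (abs_nonneg _).trans hρ
  have hCms : 0 ≤ Cm * s + em N := (abs_nonneg _).trans (hm 0)
  have hCEs : 0 ≤ CE * s + eE N := (abs_nonneg _).trans hen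
  refine ⟨?_, ?_, ?_⟩
  · calc |(∫ z, empiricalDensityField ((Φ N).flow s z) χ ∂(localGibbsLaw σ (a τ) (u τ) (θ τ) N (Φ N))) -
          ∫ z, empiricalDensityField z χ ∂(localGibbsLaw σ (a τ) (u τ) (θ τ) N (Φ N))| ≤ Cρ * s := hρ
      _ ≤ (Cρ + Cm + CE) * s + (|em N| + |eE N|) := by
          nlinarith [le_abs_self (em N), le_abs_self (eE N), abs_nonneg (em N), abs_nonneg (eE N)]
  · intro j
    calc |(∫ z, empiricalMomentumField ((Φ N).flow s z) χ j ∂(localGibbsLaw σ (a τ) (u τ) (θ τ) N (Φ N))) -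
          ∫ z, empiricalMomentumField z χ j ∂(localGibbsLaw σ (a τ) (u τ) (θ τ) N (Φ N))| ≤ Cm * s + em N := hm j
      _ ≤ (Cρ + Cm + CE) * s + (|em N| + |eE N|) := by
          nlinarith [le_abs_self (em N), le_abs_self (eE N), abs_nonneg (em N), abs_nonneg (eE N)]
  · calc |(∫ z, empiricalEnergyField ((Φ N).flow s z) χ ∂(localGibbsLaw σ (a τ) (u τ) (θ τ) N (Φ N))) -
          ∫ z, empiricalEnergyField z χ ∂(localGibbsLaw σ (a τ) (u τ) (θ τ) N (Φ N))| ≤ CE * s + eE N := hen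
      _ ≤ (Cρ + Cm + CE) * s + (|em N| + |eE N|) := by
          nlinarith [le_abs_self (em N), le_abs_self (eE N), abs_nonneg (em N), abs_nonneg (eE N)]

/-! ## The composition (sorry-free) -/

/-- COMPOSITION: the crux `RestartPrinciple` BY NAME, from the landed composition `restartPrinciple_of_meansByCharacteristics` (p132793)
fed with the PROVED items `meansByCharacteristics_holds` (15334), `stub_eulerProfileFamily` (15331), `meanClosure_holds` (11929), the
derived `stub_meanMapRegularity` (15330 ⟸ CF ∧ C3) and the residue `stub_flowBoxDecoupling` (15329). -/
theorem RestartPrinciple_of : RestartPrinciple :=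
  restartPrinciple_of_meansByCharacteristics meansByCharacteristics_holds stub_flowBoxDecoupling stub_meanMapRegularity
    Theorems.RestartPrinciple.AgeDuhamelForgetting.stub_eulerProfileFamily meanClosure_holds

end Summit.AtomisticToContinuum.HydrodynamicLimit.Cruxes.RestartPrinciple.AgeDuhamelForgetting

end
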